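import Mathlib
import HarnessLib
import Summits.CriticalPhenomena.CardyFormulaZ2.Theorems.CardyComplexConeEdgeCoherenceLeeYangIdentification
import Summits.CriticalPhenomena.CardyFormulaZ2.Theorems.CardyComplexConeEdgeCoherenceLeeYangStructure

/-!
# Vocabulary of line `Sketch`, composition `LeeYang`, III: tilted class masses (crux `EdgeCoherence`,
item stmt-CriticalPhenomena-11385)

Route `CardyComplexCone` (sub-problem `CriticalPhenomena/CardyFormulaZ2`), crux
`Summit.CriticalPhenomena.CardyFormulaZ2.Theses.CardyComplexCone.EdgeCoherence`. Third definitions module of line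
`Sketch` (lead `prover-line-stmt-CriticalPhenomena-11385-c2-0`), reshaping the open bet `Sig.stub_equidistribution` of
the composition `LeeYang` (`Theorems/CardyComplexConeEdgeCoherenceLeeYangDefs.lean`) into the vocabulary in which
percolation technology can attack it.

* `classGF E δ v c ζ` — the **class-`c` generating function**: the class-`c` summand of the winding-index generating
  function `indexGF E δ v ζ = Σ_{c : Fin 4} classGF E δ v c ζ` (`indexGF_eq_sum_classGF`), i.e.
  `E[ Σ_{passages of γ along the corner (v, faceAt v c)} ζ^{m} ]`, `m ∈ ℤ` the quarter-turn winding index of the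
  passage. At a real fugacity `x > 0` it is the `x`-TILTED CLASS MASS `N_c^{(x)}(v) = E Σ_{darts of class c at v} x^m ≥ 0`;
  at `x = 1` it is the expected number of darts of class `c` at `v`, i.e. (darts are not repeated) the probability that
  the exploration interface passes through the corner `(v, faceAt v c)`.
* `classGF_mul_I_pow` — the **class/index congruence**: along the exploration the class of the `n`-th dart is
  `c₀ + T_n (mod 4)` (`I_pow_snd_cornerOrbit`, module …LeeYangIdentification), so rotating the fugacity by `i^k`
  multiplies the class-`c` generating function by the unimodular constant `(i^c / i^{c₀})^k`:
  `classGF c (ζ i^k) = (i^c (i^{c₀})⁻¹)^k · classGF c ζ`. Hence `Z(ζ i^k) = Σ_c (i^{c−c₀})^k N_c(ζ)` is the discrete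
  Fourier transform of the class vector, and `Z(x i^k) = o(Z(x))` for `k = 1,2,3` ⟺ the four tilted class masses
  are asymptotically EQUAL.
* `Sig.stub_classBalance` — **TILTED CLASS BALANCE** (OPEN; the bet restated): for real fugacities `|x − 1| < η` the
  four tilted class masses at `v` agree to `o(Z(x))`, eventually in `δ`, uniformly for `v` over compacts;
  `Sig.stub_classBalanceOne` — its `x = 1` case: the four dart-passage probabilities at a deep vertex are
  asymptotically equal (the `π/2`-rotation invariance of the local law of the configuration seen from a typical
  interface point — "interface two-arm incipient infinite cluster"; a provable programme of size XL, recorded for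
  promotion; `classBalanceOne_of_classBalance`).
* `equidistribution_of_classBalance : Sig.stub_classBalance → Sig.stub_equidistribution` — the dictionary, PROVED
  (`Σ_c i^{kc} = 0` for `k = 1,2,3`, so `Z(x i^k) = Σ_c (i^{c−c₀})^k (N_c − N_0)` and
  `‖Z(x i^k)‖ ≤ Σ_c ‖N_c − N_0‖`).

Nothing is asserted: the two `Sig.stub_*` are `def … : Prop` statements; everything else is proved inline.

Sources: idea card `Cruxes/EdgeCoherence/Ideas/lee-yang-winding-fugacity.md`; lead analysis
`Cruxes/EdgeCoherence/Lines/Sketch-LeeYang.md` §1 (the dictionary), §2 (E1)/(E2); H. Duminil-Copin, S. Smirnov,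
*Conformal invariance of lattice models*, Clay Math. Proc. 15 (2012) §8 (Conj. 8.7); S. Smirnov, Ann. of Math. 172
(2010) §2.2 (face index ≡ number of turns).
-/

noncomputable section

namespace Summit.CriticalPhenomena.CardyFormulaZ2.Cruxes.EdgeCoherence.LeeYang

open scoped BigOperators Topology
open Filter Set MeasureTheory
open Literature.Probability.LatticeModels Literature.Probability.RandomPlanarGeometry
open Literature.Probability.Percolation (BondConfig bondPercolation half)
open Summit.CriticalPhenomena.CardyFormulaZ2.Cruxes.EdgeCoherence.FixedRadiusCut
  (cornerObs harmonic HarmonicVanishing startCorner isStartCorner_startCorner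
    medialExploration_inter_edgeSet edgeSet_finite integrable_of_forall_inter)

/-! ### The class generating functions -/

/-- **The class-`c` generating function** of the darts of the exploration path of the datum `E` at the primal
vertex `v`, read at mesh `δ`: `N_c(ζ) = E[ Σ_{passages k of γ along the corner (v, faceAt v c)} ζ^{m_k} ]`,
`m_k = round(W_k/(π/2)) ∈ ℤ` the quarter-turn winding index of the passage — VERBATIM the class-`c` summand of
`indexGF E δ v ζ` (`indexGF_eq_sum_classGF`). At a real fugacity `x > 0` this is the `x`-tilted class mass
`N_c^{(x)}(v) ≥ 0`; at `x = 1` the expected number of class-`c` darts of `γ` at `v`. -/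
def classGF (E : DiscreteDobrushin) (δ : ℝ) (v : Site 2) (c : Fin 4) (ζ : ℂ) : ℂ :=
  ∫ ω, (let γ := Literature.Probability.LatticeModels.medialExploration E ω;
    ∑ k ∈ (Finset.range γ.length).filter (fun k => γ[k]? = some
      (Literature.Probability.LatticeModels.cornerSource v (faceAt v c)) ∧ γ[k + 1]? = some
      (Literature.Probability.LatticeModels.cornerTarget v (faceAt v c))),
      ζ ^ (round (Literature.Probability.LatticeModels.Polyline.winding ((γ.map
        (Literature.Probability.LatticeModels.medialPoint δ)).take (k + 2)) / (Real.pi / 2)) : ℤ))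
    ∂(bondPercolation (zdGraph 2) half)

/-- **Class/index congruence, one dart.** If the `n`-th dart of the orbit from `c₀` has class `c`, then
`i ^ T_n = i^c · (i^{c₀})⁻¹` (`I_pow_snd_cornerOrbit`: `i^{c_n} = i^{c₀} i^{T_n}`). -/
theorem I_zpow_turnSum_eq (β' : BondConfig (Site 2)) (c₀ : Site 2 × Fin 4) (n : ℕ) {v : Site 2} {c : Fin 4}
    (h : cornerOrbit β' c₀ n = (v, c)) :
    (Complex.I : ℂ) ^ (∑ i ∈ Finset.range n, turnSign β' (cornerOrbit β' c₀ i)) =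
      Complex.I ^ (c : ℕ) * (Complex.I ^ (c₀.2 : ℕ))⁻¹ := by
  have key := I_pow_snd_cornerOrbit β' c₀ n
  rw [h] at key
  have h0 : (Complex.I : ℂ) ^ (c₀.2 : ℕ) ≠ 0 := pow_ne_zero _ Complex.I_ne_zero
  rw [eq_mul_inv_iff_mul_eq₀ h0, mul_comm]
  exact key.symm

/-- **Rotating the fugacity, one dart**: if the `n`-th dart has class `c`, then
`(ζ i^k) ^ T_n = (i^c (i^{c₀})⁻¹)^k · ζ ^ T_n`. -/
theorem mul_I_pow_zpow_turnSum (β' : BondConfig (Site 2)) (c₀ : Site 2 × Fin 4) (n k : ℕ) {v : Site 2}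
    {c : Fin 4} (h : cornerOrbit β' c₀ n = (v, c)) (ζ : ℂ) :
    (ζ * Complex.I ^ k) ^ (∑ i ∈ Finset.range n, turnSign β' (cornerOrbit β' c₀ i)) =
      (Complex.I ^ (c : ℕ) * (Complex.I ^ (c₀.2 : ℕ))⁻¹) ^ k *
        ζ ^ (∑ i ∈ Finset.range n, turnSign β' (cornerOrbit β' c₀ i)) := by
  set T := ∑ i ∈ Finset.range n, turnSign β' (cornerOrbit β' c₀ i) with hT
  have h1 : (Complex.I ^ k : ℂ) ^ T = ((Complex.I : ℂ) ^ T) ^ k := by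
    rw [← zpow_natCast (Complex.I ^ T) k, ← zpow_natCast Complex.I k, ← zpow_mul, ← zpow_mul, mul_comm]
  rw [mul_zpow, h1, I_zpow_turnSum_eq β' c₀ n h, mul_comm]

section Admissible

variable {E : DiscreteDobrushin} (hE : E.IsZdAdmissible)
include hE

/-- The class-`c` integrand reads only the edges of `Ω_δ`, hence is integrable under `P_{1/2}`. -/
theorem integrable_classTerm (δ : ℝ) (v : Site 2) (c : Fin 4) (ζ : ℂ) :
    Integrable (fun ω => (let γ := Literature.Probability.LatticeModels.medialExploration E ω;
      ∑ k ∈ (Finset.range γ.length).filter (fun k => γ[k]? = some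
        (Literature.Probability.LatticeModels.cornerSource v (faceAt v c)) ∧ γ[k + 1]? = some
        (Literature.Probability.LatticeModels.cornerTarget v (faceAt v c))),
        ζ ^ (round (Literature.Probability.LatticeModels.Polyline.winding ((γ.map
          (Literature.Probability.LatticeModels.medialPoint δ)).take (k + 2)) / (Real.pi / 2)) : ℤ)))
      (bondPercolation (zdGraph 2) half) :=
  integrable_of_forall_inter (edgeSet_finite hE) (fun ω => by simp only [medialExploration_inter_edgeSet]) _ _

/-- **The generating function is the sum of its four class parts**: `Z(ζ) = Σ_{c : Fin 4} N_c(ζ)`. -/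
theorem indexGF_eq_sum_classGF (δ : ℝ) (v : Site 2) (ζ : ℂ) :
    indexGF E δ v ζ = ∑ c : Fin 4, classGF E δ v c ζ := by
  unfold indexGF classGF
  rw [← integral_finsetSum _ fun c _ => integrable_classTerm hE δ v c ζ]

/-- **The class generating function along the orbit**: `N_c(ζ)` is the integral of the sum of `ζ ^ T_n` over the
orbit hits `n` of `(v, c)` before the exit (`indexTerm_eq`). -/
theorem classGF_eq_integral_orbit {δ : ℝ} (hδ : δ ≠ 0) (v : Site 2) (c : Fin 4) (ζ : ℂ) :
    classGF E δ v c ζ = ∫ ω, ∑ n ∈ (Finset.range ((medialExploration E ω).length - 1)).filter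
        (fun n => cornerOrbit (E.bcBondConfig ω) (startCorner E) n = (v, c)),
        ζ ^ (∑ i ∈ Finset.range n, turnSign (E.bcBondConfig ω) (cornerOrbit (E.bcBondConfig ω) (startCorner E) i))
      ∂(bondPercolation (zdGraph 2) half) := by
  unfold classGF
  exact integral_congr_ae (ae_of_all _ fun ω => indexTerm_eq hE hδ ω v c ζ)

/-- **Class/index congruence: rotating the fugacity by `i^k` multiplies the class-`c` generating function by the
unimodular constant `(i^c / i^{c₀})^k`**, `c₀` the class of the start corner:
`N_c(ζ i^k) = (i^c (i^{c₀})⁻¹)^k · N_c(ζ)` (nonzero reading mesh). -/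
theorem classGF_mul_I_pow {δ : ℝ} (hδ : δ ≠ 0) (v : Site 2) (c : Fin 4) (ζ : ℂ) (k : ℕ) :
    classGF E δ v c (ζ * Complex.I ^ k) =
      (Complex.I ^ (c : ℕ) * (Complex.I ^ ((startCorner E).2 : ℕ))⁻¹) ^ k * classGF E δ v c ζ := by
  rw [classGF_eq_integral_orbit hE hδ, classGF_eq_integral_orbit hE hδ, ← integral_const_mul]
  refine integral_congr_ae (ae_of_all _ fun ω => ?_)
  dsimp only
  rw [Finset.mul_sum]
  refine Finset.sum_congr rfl fun n hn => ?_
  obtain ⟨-, hn2⟩ := Finset.mem_filter.1 hn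
  exact mul_I_pow_zpow_turnSum _ _ n k hn2 ζ

end Admissible

/-! ### The two statements (nothing asserted) -/

/-- STUB statement — **TILTED CLASS BALANCE** (OPEN — the bet `TiltedClassEquidistribution` in percolation
vocabulary): there is `η > 0` such that for every domain, family (guards), compact `K ⊂ D` and `ε > 0`, eventually
in `δ`, at every vertex `v` over `K` and every real fugacity `|x − 1| < η`, the four `x`-tilted class masses agree
to `ε Z(x)`: `‖N_c^{(x)}(v) − N_{c'}^{(x)}(v)‖ ≤ ε ‖Z_v(x)‖`. Implies `Sig.stub_equidistribution`
(`equidistribution_of_classBalance`); data: Lines/Sketch-LeeYang.md §4 (pooled classes balanced to 0.75 % at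
L = 512, tilted ratios flat in `x ∈ [0.7, 1.4]` and decaying ≈ L^{-0.7}). -/
def Sig.stub_classBalance : Prop :=
  ∃ η > (0:ℝ), ∀ (D : DobrushinDomain) (Λ : ℝ → DiscreteDobrushin), (∀ δ, (Λ δ).Ω = D.carrier) →
    (∀ δ, (Λ δ).δ = δ) → (∀ᶠ δ in 𝓝[>] (0:ℝ), (Λ δ).IsZdAdmissible) →
    ∀ K : Set ℂ, IsCompact K → K ⊆ D.carrier → ∀ ε > (0:ℝ), ∀ᶠ δ in 𝓝[>] (0:ℝ),
      ∀ v : Site 2, meshPoint δ v ∈ K → ∀ x : ℝ, |x - 1| < η → ∀ c c' : Fin 4,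
        ‖classGF (Λ δ) δ v c x - classGF (Λ δ) δ v c' x‖ ≤ ε * ‖indexGF (Λ δ) δ v x‖

/-- STUB statement — **CLASS BALANCE AT UNIT FUGACITY** (OPEN, the `x = 1` case of `Sig.stub_classBalance`; the
promotable programme (E1) of Lines/Sketch-LeeYang.md §2): for every domain, family (guards), compact `K ⊂ D` and
`ε > 0`, eventually in `δ`, at every vertex `v` over `K` the expected numbers of darts of the four classes agree to
`ε` times their total — the `π/2`-rotation invariance of the local limit law of the configuration seen from an
interface point (interface two-arm incipient infinite cluster: Kesten 1986; Damron–Sapozhnikov 2011;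
Garban–Pete–Schramm 2013 couplings), uniformly over the point. -/
def Sig.stub_classBalanceOne : Prop :=
  ∀ (D : DobrushinDomain) (Λ : ℝ → DiscreteDobrushin), (∀ δ, (Λ δ).Ω = D.carrier) →
    (∀ δ, (Λ δ).δ = δ) → (∀ᶠ δ in 𝓝[>] (0:ℝ), (Λ δ).IsZdAdmissible) →
    ∀ K : Set ℂ, IsCompact K → K ⊆ D.carrier → ∀ ε > (0:ℝ), ∀ᶠ δ in 𝓝[>] (0:ℝ),
      ∀ v : Site 2, meshPoint δ v ∈ K → ∀ c c' : Fin 4,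
        ‖classGF (Λ δ) δ v c 1 - classGF (Λ δ) δ v c' 1‖ ≤ ε * ‖indexGF (Λ δ) δ v 1‖

/-- The unit-fugacity case is a special case of tilted class balance. -/
theorem classBalanceOne_of_classBalance : Sig.stub_classBalance → Sig.stub_classBalanceOne := by
  rintro ⟨η, hη, h⟩ D Λ hΩ hδ hadm K hK hKD ε hε
  filter_upwards [h D Λ hΩ hδ hadm K hK hKD ε hε] with δ hδ' v hv c c'
  simpa using hδ' v hv 1 (by simpa using hη) c c'

/-! ### The dictionary: class balance gives equidistribution -/

/-- `Σ_{c : Fin 4} i^{kc} = 0` for `k = 1, 2, 3` (orthogonality of the non-trivial characters of `ℤ₄`). -/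
theorem sum_I_pow_mul_eq_zero {k : ℕ} (hk : k ∈ ({1, 2, 3} : Finset ℕ)) :
    ∑ c : Fin 4, (Complex.I : ℂ) ^ (k * (c : ℕ)) = 0 := by
  simp only [Finset.mem_insert, Finset.mem_singleton] at hk
  have h3 : Complex.I ^ 3 = -Complex.I := Complex.I_pow_three
  have h4 : Complex.I ^ 4 = 1 := Complex.I_pow_four
  have h6 : Complex.I ^ 6 = -1 := by rw [show (6:ℕ) = 4 + 2 from rfl, pow_add, h4, Complex.I_sq]; ring
  have h9 : Complex.I ^ 9 = Complex.I := by rw [show (9:ℕ) = 4 + 4 + 1 from rfl, pow_add, pow_add, h4]; ring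
  rcases hk with rfl | rfl | rfl <;>
    simp [Fin.sum_univ_four, Complex.I_sq, h3, h4, h6, h9]

/-- The rotation constant is unimodular: `‖(i^c (i^{c₀})⁻¹)^k‖ = 1`. -/
theorem norm_rotConst (c c₀ : Fin 4) (k : ℕ) :
    ‖((Complex.I : ℂ) ^ (c : ℕ) * (Complex.I ^ (c₀ : ℕ))⁻¹) ^ k‖ = 1 := by
  simp [norm_pow, norm_inv, Complex.norm_I]

/-- **The rotated generating function as a character sum of class DIFFERENCES**: for admissible data, a nonzero
reading mesh and `k ∈ {1,2,3}`,
`Z(ζ i^k) = Σ_c (i^c (i^{c₀})⁻¹)^k · (N_c(ζ) − N_{c'}(ζ))` for any fixed reference class `c'`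
(`indexGF_eq_sum_classGF`, `classGF_mul_I_pow`, and `Σ_c (i^c (i^{c₀})⁻¹)^k = (i^{c₀})^{-k} Σ_c i^{kc} = 0`). -/
theorem indexGF_mul_I_pow_eq_sum_sub {E : DiscreteDobrushin} (hE : E.IsZdAdmissible) {δ : ℝ} (hδ : δ ≠ 0)
    (v : Site 2) (ζ : ℂ) {k : ℕ} (hk : k ∈ ({1, 2, 3} : Finset ℕ)) (c' : Fin 4) :
    indexGF E δ v (ζ * Complex.I ^ k) =
      ∑ c : Fin 4, (Complex.I ^ (c : ℕ) * (Complex.I ^ ((startCorner E).2 : ℕ))⁻¹) ^ k *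
        (classGF E δ v c ζ - classGF E δ v c' ζ) := by
  have hsum : ∑ c : Fin 4, ((Complex.I : ℂ) ^ (c : ℕ) * (Complex.I ^ ((startCorner E).2 : ℕ))⁻¹) ^ k = 0 := by
    have : ∑ c : Fin 4, ((Complex.I : ℂ) ^ (c : ℕ) * (Complex.I ^ ((startCorner E).2 : ℕ))⁻¹) ^ k =
        ((Complex.I ^ ((startCorner E).2 : ℕ))⁻¹) ^ k * ∑ c : Fin 4, (Complex.I : ℂ) ^ (k * (c : ℕ)) := by
      rw [Finset.mul_sum]
      refine Finset.sum_congr rfl fun c _ => ?_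
      rw [pow_mul']
      ring
    rw [this, sum_I_pow_mul_eq_zero hk, mul_zero]
  rw [indexGF_eq_sum_classGF hE]
  simp_rw [mul_sub, Finset.sum_sub_distrib, ← Finset.sum_mul, hsum, zero_mul, sub_zero]
  exact Finset.sum_congr rfl fun c _ => classGF_mul_I_pow hE hδ v c ζ k

/-- **Class balance bounds the rotated values**: `‖Z(ζ i^k)‖ ≤ Σ_c ‖N_c(ζ) − N_{c'}(ζ)‖` (`k ∈ {1,2,3}`). -/
theorem norm_indexGF_mul_I_pow_le {E : DiscreteDobrushin} (hE : E.IsZdAdmissible) {δ : ℝ} (hδ : δ ≠ 0)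
    (v : Site 2) (ζ : ℂ) {k : ℕ} (hk : k ∈ ({1, 2, 3} : Finset ℕ)) (c' : Fin 4) :
    ‖indexGF E δ v (ζ * Complex.I ^ k)‖ ≤ ∑ c : Fin 4, ‖classGF E δ v c ζ - classGF E δ v c' ζ‖ := by
  rw [indexGF_mul_I_pow_eq_sum_sub hE hδ v ζ hk c']
  refine (norm_sum_le _ _).trans (le_of_eq (Finset.sum_congr rfl fun c _ => ?_))
  rw [norm_mul, norm_rotConst, one_mul]

/-- **The dictionary: TILTED CLASS BALANCE ⇒ EQUIDISTRIBUTION** (`Sig.stub_classBalance → Sig.stub_equidistribution`,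
with the same `η`): eventually in `δ` the data are admissible and `δ > 0`, and at a balanced vertex
`‖Z(x i^k)‖ ≤ Σ_c ‖N_c − N_0‖ ≤ 4 · (ε/4) ‖Z(x)‖`. -/
theorem equidistribution_of_classBalance : Sig.stub_classBalance → Sig.stub_equidistribution := by
  rintro ⟨η, hη, h⟩
  refine ⟨η, hη, fun D Λ hΩ hδ hadm K hK hKD ε hε => ?_⟩
  filter_upwards [h D Λ hΩ hδ hadm K hK hKD (ε / 4) (by positivity), hadm, self_mem_nhdsWithin]
    with δ hbal hadmδ hpos v hv x hx k hk
  have hδ0 : δ ≠ 0 := ne_of_gt hpos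
  calc ‖indexGF (Λ δ) δ v ((x : ℂ) * Complex.I ^ k)‖
      ≤ ∑ c : Fin 4, ‖classGF (Λ δ) δ v c x - classGF (Λ δ) δ v 0 x‖ :=
        norm_indexGF_mul_I_pow_le hadmδ hδ0 v x hk 0
    _ ≤ ∑ _c : Fin 4, ε / 4 * ‖indexGF (Λ δ) δ v x‖ := Finset.sum_le_sum fun c _ => hbal v hv x hx c 0
    _ = ε * ‖indexGF (Λ δ) δ v x‖ := by simp [Finset.sum_const, Finset.card_univ]; ring

end Summit.CriticalPhenomena.CardyFormulaZ2.Cruxes.EdgeCoherence.LeeYang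

end
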